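import Summits.AnomalousDissipation.AnomalousDissipation.Theorems.FloorCertificate.Negative.WeakDuality

/-!
# Stub `stub_weakDualityBudget` (A) of the line `Sketch`
# (crux stmt-AnomalousDissipation-14086, `TaylorCertificates.FloorCertificateEnsembleCeiling`)

WEAK DUALITY WITH A STATE-DEPENDENT BUDGET over the relaxed class. If a budget `g : H → ℝ` obeys
the floor `g(u) ≤ ν‖∇u‖² + ⟨F(u), Φ₁'(u)⟩ + 2θ₁((u,f) − ν‖∇u‖²)` at every finite-enstrophy state
`u` of the Leray ball `|u|² ≤ 16‖f‖²/ν²`, with `θ₁ ≤ 0`, and `μ` is a probability measure on the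
energy space `H` carried by that ball, of finite mean enstrophy `Torus.ensembleEnstrophy μ < ∞`,
annihilating the Liouville functional of `Φ₁` (`∫ ⟨F(u), Φ₁'(u)⟩ dμ = 0`), with integrable work
`(u,f)` and the global energy inequality `ε(μ) := Torus.ensembleDissipation ν μ ≤ ∫ (u,f) dμ`, then
`∫ g dμ ≤ ε(μ)` for every `μ`-integrable `g`.

Proof. `μ`-a.e. state has finite enstrophy (`ae_lt_top`) and lies in the ball, so the budget floor
holds `μ`-a.e.; integrate it (`integral_mono_ae`) and split the right-hand side: the Liouville
identity kills the generator term, `integral_toReal` turns `∫ ‖∇u‖²` into the mean enstrophy, and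
`2θ₁ (∫(u,f)dμ − ε(μ)) ≤ 0` by `θ₁ ≤ 0` and the energy inequality. This is verbatim the landed
`FloorCertificate.Negative.floorFamily_le_ensembleDissipation` with the constant budget `ε₀`
replaced by `g`.

References: Foias–Manley–Rosa–Temam 2001, Ch. IV Def. 1.3 and Ch. V §1 (stationary statistical
solutions, mean dissipation); Doering–Foias 2002, §2.
-/

set_option linter.dupNamespace false

noncomputable section

namespace Summit.AnomalousDissipation.AnomalousDissipation.Theorems.TaylorCertificatesFloorCertificateEnsembleCeiling

open MeasureTheory
open scoped ENNReal
open Literature.Analysis.FunctionSpaces Literature.Analysis.FluidPDE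

/-- Local notation: real vector fields on `T³`. -/
local notation "Vec3" => (UnitAddTorus (Fin 3)) → (EuclideanSpace ℝ (Fin 3))
/-- Local notation: `L²(T³; ℝ³)`. -/
local notation "L2" => (Lp (EuclideanSpace ℝ (Fin 3)) 2 (volume : Measure (UnitAddTorus (Fin 3))))
/-- Local notation: the energy space `H`. -/
local notation "H3" => (Torus.energySpace (Fin 3))

/-- **Weak duality with a state-dependent budget (relaxed class).** If
`g(u) ≤ ν‖∇u‖² + ⟨F(u),Φ₁'(u)⟩ + 2θ₁((u,f) − ν‖∇u‖²)` at every finite-enstrophy state of the Leray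
ball, `θ₁ ≤ 0`, and `μ` is a probability measure on `H` carried by the ball, of finite mean
enstrophy, annihilating the Liouville functional of `Φ₁`, with integrable work `(u,f)` and the
global energy inequality `ε(μ) ≤ ∫(u,f)dμ`, then `∫ g dμ ≤ ε(μ)` (for `μ`-integrable `g`). The budget
floor holds `μ`-a.e. (finite enstrophy a.e. by `ae_lt_top`, ball a.e.); integrate
(`integral_mono_ae`); the Liouville identity kills the generator term (`integral_toReal` for the
enstrophy), and `2θ₁(∫(u,f) − ε) ≤ 0`. -/
theorem stub_weakDualityBudget :
    ∀ (ν : ℝ) (f : Vec3) (Φ₁ : Torus.CylindricalTest (Fin 3)) (θ₁ : ℝ) (g : H3 → ℝ) (μ : Measure H3),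
      θ₁ ≤ 0 →
      (∀ u : H3, Torus.eGradNormSq ((u : L2) : Vec3) ≠ ⊤ → ‖u‖ ^ 2 ≤ 16 * (∫ x, ‖f x‖ ^ 2) / ν ^ 2 →
        g u ≤ ν * (Torus.eGradNormSq ((u : L2) : Vec3)).toReal + Torus.nsGeneratorPairing ν f u (Φ₁.grad u) +
          2 * θ₁ * (Torus.pairing (u : L2) f - ν * (Torus.eGradNormSq ((u : L2) : Vec3)).toReal)) →
      IsProbabilityMeasure μ →
      (∀ᵐ u ∂μ, ‖u‖ ^ 2 ≤ 16 * (∫ x, ‖f x‖ ^ 2) / ν ^ 2) →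
      Torus.ensembleEnstrophy μ < ⊤ →
      Integrable (fun u : H3 => Torus.nsGeneratorPairing ν f u (Φ₁.grad u)) μ →
      ∫ u, Torus.nsGeneratorPairing ν f u (Φ₁.grad u) ∂μ = 0 →
      Integrable (fun u : H3 => Torus.pairing (u : L2) f) μ →
      Torus.ensembleDissipation ν μ ≤ ∫ u, Torus.pairing (u : L2) f ∂μ →
      Integrable g μ →
      ∫ u, g u ∂μ ≤ Torus.ensembleDissipation ν μ := by
  intro ν f Φ₁ θ₁ g μ hθ₁ hfloor _hprob hball hZ hC hC0 hB hE hg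
  set G : H3 → ℝ≥0∞ := fun u => Torus.eGradNormSq ((u : L2) : Vec3)
  have hGm : Measurable G := Torus.measurable_eGradNormSq_coe
  have hGfin : ∫⁻ u, G u ∂μ < ∞ := hZ
  have hGlt : ∀ᵐ u ∂μ, G u < ∞ := ae_lt_top hGm hGfin.ne
  have hA : Integrable (fun u => (G u).toReal) μ :=
    integrable_toReal_of_lintegral_ne_top hGm.aemeasurable hGfin.ne
  -- the budget FLOOR holds `μ`-a.e.
  have hae : ∀ᵐ u ∂μ, g u ≤ ν * (G u).toReal + Torus.nsGeneratorPairing ν f u (Φ₁.grad u) +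
      2 * θ₁ * (Torus.pairing (u : L2) f - ν * (G u).toReal) := by
    filter_upwards [hGlt, hball] with u hu hb
    exact hfloor u hu.ne hb
  -- integrate
  have h1 : Integrable (fun u : H3 => ν * (G u).toReal) μ := hA.const_mul ν
  have h2 : Integrable
      (fun u : H3 => ν * (G u).toReal + Torus.nsGeneratorPairing ν f u (Φ₁.grad u)) μ :=
    h1.add hC
  have h3 : Integrable (fun u : H3 => Torus.pairing (u : L2) f - ν * (G u).toReal) μ := hB.sub h1
  have h4 : Integrable
      (fun u : H3 => 2 * θ₁ * (Torus.pairing (u : L2) f - ν * (G u).toReal)) μ :=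
    h3.const_mul _
  have hint : Integrable (fun u : H3 => ν * (G u).toReal + Torus.nsGeneratorPairing ν f u (Φ₁.grad u) +
      2 * θ₁ * (Torus.pairing (u : L2) f - ν * (G u).toReal)) μ := h2.add h4
  have hmono := integral_mono_ae hg hint hae
  have hsplit : ∫ u : H3, (ν * (G u).toReal + Torus.nsGeneratorPairing ν f u (Φ₁.grad u) +
      2 * θ₁ * (Torus.pairing (u : L2) f - ν * (G u).toReal)) ∂μ =
      ν * (∫⁻ u, G u ∂μ).toReal + 0 +
        2 * θ₁ * (∫ u : H3, Torus.pairing (u : L2) f ∂μ - ν * (∫⁻ u, G u ∂μ).toReal) := by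
    rw [integral_add h2 h4, integral_add h1 hC, integral_const_mul, integral_const_mul,
      integral_sub hB h1, integral_const_mul, hC0, integral_toReal hGm.aemeasurable hGlt]
  rw [hsplit] at hmono
  -- the global energy inequality `ν ∫‖∇u‖² ≤ ∫ (u,f)`
  have hE' : ν * (∫⁻ u, G u ∂μ).toReal ≤ ∫ u, Torus.pairing (u : L2) f ∂μ := hE
  have hθ : 2 * θ₁ * (∫ u, Torus.pairing (u : L2) f ∂μ - ν * (∫⁻ u, G u ∂μ).toReal) ≤ 0 :=
    mul_nonpos_of_nonpos_of_nonneg (by linarith) (by linarith)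
  change ∫ u, g u ∂μ ≤ ν * (∫⁻ u, G u ∂μ).toReal
  linarith

end Summit.AnomalousDissipation.AnomalousDissipation.Theorems.TaylorCertificatesFloorCertificateEnsembleCeiling
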